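import Literature.NumberTheory.Sieve.BombieriFriedlanderIwaniecDispersion
import Literature.NumberTheory.Sieve.BombieriVinogradovReduction
import Literature.NumberTheory.Sieve.PrimePowersInProgressions
import HarnessLib

/-!
# Bombieri–Friedlander–Iwaniec 1986: the trivial bound for the brackets of `𝒟` summed over moduli

Trunk `AntSieve`, companion to `Literature.NumberTheory.Sieve.BombieriFriedlanderIwaniecDispersion`.
Everything here is PROVED.  In the assembly of Theorem 10 along §§15, 17 of the source, a grouped
Heath-Brown piece `α ⋆ β` whose `β` is too sparse to satisfy hypothesis (A₅) of Theorem 2 (or whose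
bound from Theorems 1, 2, 5* would be worse than trivial) is discarded by the TRIVIAL estimate: for
each modulus `d` one counts the `m ∼ M` in the single class `m ≡ a n̄ (mod d)` (BFI use such trivial
estimations repeatedly, e.g. §6 p. 219 "We first estimate trivially …", §12 (12.1)).  We prove it in
the form consumed there:

* `Literature.NumberTheory.Sieve.BFI.card_dyadic_filter_mul_natCast_eq_le` — for `(d, a) = 1` and any `n`,
  `#{m ∼ M : mn ≡ a (mod d)} ≤ 2M/d + 1` (no solution unless `(n, d) = 1`, then one class).
* `Literature.NumberTheory.Sieve.BFI.sum_abs_bracket_le` — for `|α| ≤ A` on `m ∼ M` and any `β` on `n ∼ N`,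
  `∑_{d ≤ D, (d,a)=1} |∑_{m∼M, n∼N, mn≡a (d)} α_m β_n − φ(d)⁻¹ ∑_{m∼M, n∼N, (mn,d)=1} α_m β_n|
     ≤ A (∑_{n∼N} |β_n|) ((2M + 1)((1 + log D) + (1 + log D)²) + D)`,
  i.e. `≪ A ‖β‖₁ (M log² D + D)`; the brackets are those of BFI (3.1) (`Literature.NumberTheory.Sieve.BFI.dispD`) at the
  modulus `d = qr`, cf. `Literature.NumberTheory.Sieve.BFI.apDiscrepancy_mul_eq_of_support` (`…Grouping`).

## References

* E. Bombieri, J. B. Friedlander, H. Iwaniec, *Primes in arithmetic progressions to large moduli*,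
  Acta Math. 156 (1986), 203–251, §3 (3.1) p. 214, §6 p. 219. [BombieriFriedlanderIwaniecActa1986]
-/

open Finset Real

namespace Literature.NumberTheory.Sieve

namespace BFI

/-- `m ∼ M` lies in `[0, ⌊2M⌋]`. [folklore] -/
theorem dyadic_subset_range (M : ℝ) : dyadic M ⊆ range (⌊2 * M⌋₊ + 1) :=
  Finset.filter_subset _ _

/-- `#{m ∼ M} ≤ 2M + 1` for `M ≥ 0`. [folklore] -/
theorem card_dyadic_le {M : ℝ} (hM : 0 ≤ M) : (#(dyadic M) : ℝ) ≤ 2 * M + 1 := by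
  calc (#(dyadic M) : ℝ) ≤ #(range (⌊2 * M⌋₊ + 1)) := by
        exact_mod_cast Finset.card_le_card (dyadic_subset_range M)
    _ = ⌊2 * M⌋₊ + 1 := by rw [Finset.card_range]; push_cast; ring
    _ ≤ 2 * M + 1 := by linarith [Nat.floor_le (by linarith : 0 ≤ 2 * M)]

/-- **One class per modulus.**  If `(d, a) = 1` then for every `n` the `m ∼ M` with `mn ≡ a (mod d)`
lie in a single residue class (there are none unless `(n, d) = 1`, and then `m ≡ a n̄`), so their
number is `≤ 2M/d + 1`. [folklore] -/
theorem card_dyadic_filter_mul_natCast_eq_le {M : ℝ} (hM : 0 ≤ M) {d : ℕ} (hd : 1 ≤ d) {a : ℤ}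
    (hda : IsCoprime (d : ℤ) a) (n : ℕ) :
    (#((dyadic M).filter fun m : ℕ => ((m * n : ℕ) : ZMod d) = (a : ZMod d)) : ℝ) ≤
      2 * M / d + 1 := by
  have hRHS : (0 : ℝ) ≤ 2 * M / d := by positivity
  by_cases hsol : ∃ m₀ : ℕ, ((m₀ * n : ℕ) : ZMod d) = (a : ZMod d)
  · obtain ⟨m₀, hm₀⟩ := hsol
    -- `n` is a unit mod `d`
    have hn : d.Coprime n := by
      refine coprime_of_natCast_mul_eq hda (m := n) (n := m₀) ?_
      rwa [mul_comm]
    set u : (ZMod d)ˣ := ZMod.unitOfCoprime n hn.symm with hu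
    have hun : (u : ZMod d) = (n : ZMod d) := ZMod.coe_unitOfCoprime n hn.symm
    -- the condition is `m ≡ a u⁻¹`
    set t : ZMod d := (a : ZMod d) * (u⁻¹ : (ZMod d)ˣ) with ht
    have hiff : ∀ m : ℕ, ((m * n : ℕ) : ZMod d) = (a : ZMod d) ↔ (m : ZMod d) = t := by
      intro m
      rw [Nat.cast_mul, ← hun, ht]
      constructor
      · intro h; rw [← h, mul_assoc, Units.mul_inv, mul_one]
      · intro h; rw [h, mul_assoc, Units.inv_mul, mul_one]
    have hsub : (dyadic M).filter (fun m : ℕ => ((m * n : ℕ) : ZMod d) = (a : ZMod d)) ⊆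
        (range (⌊2 * M⌋₊ + 1)).filter fun m : ℕ => (m : ZMod d) = t := by
      intro m hm
      rw [Finset.mem_filter] at hm ⊢
      exact ⟨dyadic_subset_range M hm.1, (hiff m).1 hm.2⟩
    calc (#((dyadic M).filter fun m : ℕ => ((m * n : ℕ) : ZMod d) = (a : ZMod d)) : ℝ)
        ≤ #((range (⌊2 * M⌋₊ + 1)).filter fun m : ℕ => (m : ZMod d) = t) := by
          exact_mod_cast Finset.card_le_card hsub
      _ ≤ ((⌊2 * M⌋₊ / d + 1 : ℕ) : ℝ) := by
          exact_mod_cast card_range_filter_natCast_eq_le d t ⌊2 * M⌋₊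
      _ ≤ 2 * M / d + 1 := by
          push_cast
          have h1 : ((⌊2 * M⌋₊ / d : ℕ) : ℝ) ≤ (⌊2 * M⌋₊ : ℝ) / d := Nat.cast_div_le
          have h2 : (⌊2 * M⌋₊ : ℝ) / d ≤ 2 * M / d :=
            div_le_div_of_nonneg_right (Nat.floor_le (by linarith)) (Nat.cast_nonneg d)
          linarith
  · -- no solution: the set is empty
    push Not at hsol
    have : (dyadic M).filter (fun m : ℕ => ((m * n : ℕ) : ZMod d) = (a : ZMod d)) = ∅ :=
      Finset.filter_eq_empty_iff.2 fun m _ => hsol m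
    rw [this, Finset.card_empty, Nat.cast_zero]
    linarith

/-- **The trivial bound for the brackets of `𝒟`, summed over moduli coprime to `a`.**  Let `|α_m| ≤ A`
for all `m`, `M ≥ 0`, and `β` arbitrary (any `N`).  Then
`∑_{1 ≤ d ≤ D, (d,a)=1} |∑_{m∼M} ∑_{n∼N, mn≡a (d)} α_m β_n − φ(d)⁻¹ ∑_{m∼M} ∑_{n∼N, (mn,d)=1} α_m β_n|
  ≤ A (∑_{n∼N} |β_n|) ((2M + 1)((1 + log D) + (1 + log D)²) + D)`.
PROVED: for each `d`, the congruence sum is at most `A ∑_n |β_n| (2M/d + 1)`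
(`card_dyadic_filter_mul_natCast_eq_le`) and the coprimality sum at most `A (2M+1) ∑_n |β_n| / φ(d)`;
then `∑_{d ≤ D} 1/d ≤ 1 + log D` and `∑_{d ≤ D} 1/φ(d) ≤ (1 + log D)²`.
[cite: BombieriFriedlanderIwaniecActa1986, §3 (3.1) p. 214; §6 p. 219] -/
theorem sum_abs_bracket_le {α β : ℕ → ℝ} {M N A : ℝ} (hM : 0 ≤ M) (hA0 : 0 ≤ A)
    (hα : ∀ m, |α m| ≤ A) (a : ℤ) (Dn : ℕ) :
    ∑ d ∈ (Icc 1 Dn).filter (fun d : ℕ => IsCoprime (d : ℤ) a),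
        |(∑ m ∈ dyadic M, ∑ n ∈ dyadic N,
            if ((m * n : ℕ) : ZMod d) = (a : ZMod d) then α m * β n else 0) -
          (∑ m ∈ dyadic M, ∑ n ∈ dyadic N,
            if (m * n).Coprime d then α m * β n else 0) / (Nat.totient d : ℝ)| ≤
      A * (∑ n ∈ dyadic N, |β n|) *
        ((2 * M + 1) * ((1 + Real.log Dn) + (1 + Real.log Dn) ^ 2) + Dn) := by
  set S₁ : ℝ := ∑ n ∈ dyadic N, |β n| with hS₁
  have hS₁0 : 0 ≤ S₁ := Finset.sum_nonneg fun n _ => abs_nonneg _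
  have hlog0 : 0 ≤ Real.log Dn := Real.log_natCast_nonneg Dn
  -- per modulus
  have hd : ∀ d ∈ (Icc 1 Dn).filter (fun d : ℕ => IsCoprime (d : ℤ) a),
      |(∑ m ∈ dyadic M, ∑ n ∈ dyadic N,
          if ((m * n : ℕ) : ZMod d) = (a : ZMod d) then α m * β n else 0) -
        (∑ m ∈ dyadic M, ∑ n ∈ dyadic N,
          if (m * n).Coprime d then α m * β n else 0) / (Nat.totient d : ℝ)| ≤
        A * S₁ * (2 * M / d + 1) + A * S₁ * (2 * M + 1) * ((Nat.totient d : ℝ))⁻¹ := by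
    intro d hdm
    rw [Finset.mem_filter, mem_Icc] at hdm
    obtain ⟨⟨hd1, -⟩, hda⟩ := hdm
    have hφ : 0 < (Nat.totient d : ℝ) := by exact_mod_cast Nat.totient_pos.2 hd1
    refine (abs_sub _ _).trans (add_le_add ?_ ?_)
    · -- the congruence sum
      calc |∑ m ∈ dyadic M, ∑ n ∈ dyadic N,
              if ((m * n : ℕ) : ZMod d) = (a : ZMod d) then α m * β n else 0|
          ≤ ∑ m ∈ dyadic M, ∑ n ∈ dyadic N,
              if ((m * n : ℕ) : ZMod d) = (a : ZMod d) then A * |β n| else 0 := by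
            refine (Finset.abs_sum_le_sum_abs _ _).trans (Finset.sum_le_sum fun m _ => ?_)
            refine (Finset.abs_sum_le_sum_abs _ _).trans (Finset.sum_le_sum fun n _ => ?_)
            split_ifs
            · rw [abs_mul]; exact mul_le_mul_of_nonneg_right (hα m) (abs_nonneg _)
            · simp
        _ = ∑ n ∈ dyadic N, A * |β n| *
              #((dyadic M).filter fun m : ℕ => ((m * n : ℕ) : ZMod d) = (a : ZMod d)) := by
            rw [Finset.sum_comm]
            refine Finset.sum_congr rfl fun n _ => ?_
            rw [← Finset.sum_filter, Finset.sum_const, nsmul_eq_mul, mul_comm]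
        _ ≤ ∑ n ∈ dyadic N, A * |β n| * (2 * M / d + 1) :=
            Finset.sum_le_sum fun n _ => mul_le_mul_of_nonneg_left
              (card_dyadic_filter_mul_natCast_eq_le hM hd1 hda n) (by positivity)
        _ = A * S₁ * (2 * M / d + 1) := by rw [hS₁, Finset.mul_sum, Finset.sum_mul]
    · -- the coprimality sum
      rw [abs_div, abs_of_pos hφ, div_eq_mul_inv]
      refine mul_le_mul_of_nonneg_right ?_ (inv_nonneg.2 hφ.le)
      calc |∑ m ∈ dyadic M, ∑ n ∈ dyadic N, if (m * n).Coprime d then α m * β n else 0|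
          ≤ ∑ m ∈ dyadic M, ∑ n ∈ dyadic N, A * |β n| := by
            refine (Finset.abs_sum_le_sum_abs _ _).trans (Finset.sum_le_sum fun m _ => ?_)
            refine (Finset.abs_sum_le_sum_abs _ _).trans (Finset.sum_le_sum fun n _ => ?_)
            split_ifs
            · rw [abs_mul]; exact mul_le_mul_of_nonneg_right (hα m) (abs_nonneg _)
            · rw [abs_zero]; positivity
        _ = #(dyadic M) * (A * S₁) := by
            rw [Finset.sum_const, nsmul_eq_mul, hS₁]
            congr 1
            rw [Finset.mul_sum]
        _ ≤ (2 * M + 1) * (A * S₁) :=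
            mul_le_mul_of_nonneg_right (card_dyadic_le hM) (by positivity)
        _ = A * S₁ * (2 * M + 1) := by ring
  refine (Finset.sum_le_sum hd).trans ?_
  -- extend to all `d ≤ Dn` and sum the harmonic-type series
  have hnonneg : ∀ d ∈ Icc 1 Dn, 0 ≤ A * S₁ * (2 * M / d + 1) + A * S₁ * (2 * M + 1) * ((Nat.totient d : ℝ))⁻¹ :=
    fun d _ => by positivity
  refine (Finset.sum_le_sum_of_subset_of_nonneg (Finset.filter_subset _ _)
    fun d hd' _ => hnonneg d hd').trans ?_
  rw [Finset.sum_add_distrib, ← Finset.mul_sum, ← Finset.mul_sum, Finset.sum_add_distrib,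
    Finset.sum_const, Nat.card_Icc, nsmul_eq_mul]
  have h1 : ∑ d ∈ Icc 1 Dn, 2 * M / (d : ℝ) = 2 * M * ∑ d ∈ Icc 1 Dn, ((d : ℝ))⁻¹ := by
    rw [Finset.mul_sum]; exact Finset.sum_congr rfl fun d _ => by rw [div_eq_mul_inv]
  rw [h1]
  have hharm := Literature.NumberTheory.Sieve.harmonic_Icc_le Dn
  have htot : ∑ d ∈ Icc 1 Dn, ((Nat.totient d : ℝ))⁻¹ ≤ (1 + Real.log Dn) ^ 2 :=
    Literature.NumberTheory.Sieve.totientInvSum_le Dn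
  have hsum0 : 0 ≤ ∑ d ∈ Icc 1 Dn, ((d : ℝ))⁻¹ := Finset.sum_nonneg fun d _ => by positivity
  have hDn : ((Dn + 1 - 1 : ℕ) : ℝ) = Dn := by push_cast; ring
  rw [hDn]
  have hAS : 0 ≤ A * S₁ := by positivity
  calc A * S₁ * (2 * M * ∑ d ∈ Icc 1 Dn, ((d : ℝ))⁻¹ + (Dn : ℝ) * 1) +
        A * S₁ * (2 * M + 1) * ∑ d ∈ Icc 1 Dn, ((Nat.totient d : ℝ))⁻¹
      ≤ A * S₁ * (2 * M * (1 + Real.log Dn) + Dn) + A * S₁ * (2 * M + 1) * (1 + Real.log Dn) ^ 2 := by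
        gcongr
        · linarith
    _ ≤ A * S₁ * ((2 * M + 1) * ((1 + Real.log Dn) + (1 + Real.log Dn) ^ 2) + Dn) := by
        have : 2 * M * (1 + Real.log Dn) ≤ (2 * M + 1) * (1 + Real.log Dn) := by nlinarith
        nlinarith

end BFI

end Literature.NumberTheory.Sieve
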